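import Summits.QuantumAdvantage.QuantumAdvantage.Theorems.CharDialCountDialD
import Summits.QuantumAdvantage.QuantumAdvantage.Theorems.CharDialCountDialG
import Mathlib.Analysis.SpecialFunctions.Stirling
import Mathlib.Analysis.Complex.ExponentialBounds
import HarnessLib

/-!
# CharDial ▸ CountDial, part H — `SmallOrbitBlocks` in the kernel, II: the Stirling arithmetic, the big classes, ★★ `smallOrbitBlocks_holds`,
# and the support-free carving Leaf ⟸ EC ∧ FewLonely ∧ ExactFromAlmost

Part H of «CountDial» (NODE-g24.md §0/§4′): ★ `sob_arith` — `N! ≤ (m/D)^N · C^{m+1}` is impossible once `m + 1 ≤ 2kN` and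
`D > 6k·C^{2k}` (Mathlib `Stirling.le_factorial_stirling`, `Real.exp_one_lt_d9`); the BIG classes (`> m/D` points) are fewer than `D`
(`card_bigAnch_lt`) and carry the colours; ★★ `smallOrbitBlocks_holds : SmallOrbitBlocks` with `K(C,k) = 6k·C^{2k} + 1`.  Consequences
(all kernel, no support, no LEMMA Z): ★ `almostFewL_of_orbitBound` (an orbit bound alone puts, for every `k`, all but a `1/k` fraction of the
coordinates' non-lonely part into `≤ K` classes), ★★ `almostFewTypes_of_expCount_lonely : EC → FewLonely → AFT`, ★★★ `fewTypes_of_pieces'' :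
EC → FewLonely → ExactFromAlmost → Leaf`, `structureLaw_of_pieces''`, and EXACTNESS ★★★ `structureLaw_iff_pieces : PF → (B ↔ EC ∧ FL ∧ AFT ∧ X)`.

Kernel standard: no placeholders; axioms [propext, Classical.choice, Quot.sound] only (guards at the end); closed computations by kernel `decide`.
-/

set_option autoImplicit false
set_option linter.dupNamespace false

namespace Summit.QuantumAdvantage.QuantumAdvantage.Theorems.CountDial

open Classical
open Finset
open Summit.QuantumAdvantage.AdviceFreeQNC0
open Literature.Computability.MetaComplexity Literature.Computability.MetaComplexity.Smolensky
open Summit.QuantumAdvantage.QuantumAdvantage.Theorems.TransferDial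

section SOBKernel
variable {m : ℕ}

/-! ### The arithmetic (Stirling) -/

/-- ★ ARITHMETIC: `N! ≤ (m/D)^N · C^{m+1}` is impossible once `m + 1 ≤ 2kN` and `D > 6k·C^{2k}`
(Stirling `(N/e)^N ≤ N!` and `e < 3`). -/
theorem sob_arith {C k D N m : ℕ} (hk : 0 < k) (hC : 1 ≤ C) (hD : 6 * k * C ^ (2 * k) < D) (hN : m + 1 ≤ 2 * k * N)
    (h : Nat.factorial N ≤ (m / D) ^ N * C ^ (m + 1)) : False := by
  have hN1 : 1 ≤ N := by
    rcases Nat.eq_zero_or_pos N with h0 | h0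
    · subst h0; simp at hN
    · exact h0
  have hDpos : (0 : ℝ) < D := by exact_mod_cast (lt_of_le_of_lt (Nat.zero_le _) hD)
  have hR : ((N : ℝ) / Real.exp 1) ^ N ≤ ((m : ℝ) / D * (C : ℝ) ^ (2 * k)) ^ N := by
    have h1 : ((N : ℝ) / Real.exp 1) ^ N ≤ (Nat.factorial N : ℝ) := by
      have hs := Stirling.le_factorial_stirling N
      have hsq : (1 : ℝ) ≤ Real.sqrt (2 * Real.pi * N) := by
        rw [Real.one_le_sqrt]
        have : (1 : ℝ) ≤ N := by exact_mod_cast hN1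
        nlinarith [Real.pi_gt_three]
      have hpos : (0 : ℝ) ≤ ((N : ℝ) / Real.exp 1) ^ N := by positivity
      calc ((N : ℝ) / Real.exp 1) ^ N = 1 * ((N : ℝ) / Real.exp 1) ^ N := (one_mul _).symm
        _ ≤ Real.sqrt (2 * Real.pi * N) * ((N : ℝ) / Real.exp 1) ^ N := mul_le_mul_of_nonneg_right hsq hpos
        _ ≤ _ := hs
    have h2 : (Nat.factorial N : ℝ) ≤ ((m / D : ℕ) : ℝ) ^ N * (C : ℝ) ^ (m + 1) := by exact_mod_cast h
    have h3 : ((m / D : ℕ) : ℝ) ≤ (m : ℝ) / D := Nat.cast_div_le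
    have h4 : (C : ℝ) ^ (m + 1) ≤ ((C : ℝ) ^ (2 * k)) ^ N := by
      rw [← pow_mul]
      exact pow_le_pow_right₀ (by exact_mod_cast hC) hN
    calc ((N : ℝ) / Real.exp 1) ^ N ≤ (Nat.factorial N : ℝ) := h1
      _ ≤ ((m / D : ℕ) : ℝ) ^ N * (C : ℝ) ^ (m + 1) := h2
      _ ≤ ((m : ℝ) / D) ^ N * ((C : ℝ) ^ (2 * k)) ^ N :=
          mul_le_mul (pow_le_pow_left₀ (by positivity) h3 N) h4 (by positivity) (by positivity)
      _ = ((m : ℝ) / D * (C : ℝ) ^ (2 * k)) ^ N := by rw [mul_pow]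
  have hroot : (N : ℝ) / Real.exp 1 ≤ (m : ℝ) / D * (C : ℝ) ^ (2 * k) := by
    by_contra hc
    rw [not_le] at hc
    have := pow_lt_pow_left₀ hc (by positivity) (by omega : N ≠ 0)
    exact absurd hR (not_le.2 this)
  have he : Real.exp 1 < 3 := lt_trans Real.exp_one_lt_d9 (by norm_num)
  have hepos : 0 < Real.exp 1 := Real.exp_pos 1
  have hND : (N : ℝ) * D ≤ Real.exp 1 * m * (C : ℝ) ^ (2 * k) := by
    have h5 := (div_le_iff₀ hepos).1 hroot
    have h' : (N : ℝ) * D ≤ ((m : ℝ) / D * (C : ℝ) ^ (2 * k) * Real.exp 1) * D :=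
      mul_le_mul_of_nonneg_right h5 hDpos.le
    calc (N : ℝ) * D ≤ ((m : ℝ) / D * (C : ℝ) ^ (2 * k) * Real.exp 1) * D := h'
      _ = Real.exp 1 * m * (C : ℝ) ^ (2 * k) := by field_simp
  have hCk : (0 : ℝ) ≤ (C : ℝ) ^ (2 * k) := by positivity
  have hm0 : (0 : ℝ) ≤ m := Nat.cast_nonneg m
  have hkpos : (0 : ℝ) < k := by exact_mod_cast hk
  have hm1 : ((m : ℝ) + 1) * D ≤ 2 * k * (N * D) := by
    have : ((m : ℝ) + 1) ≤ 2 * k * N := by exact_mod_cast hN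
    nlinarith
  have hD' : (6 : ℝ) * k * (C : ℝ) ^ (2 * k) < D := by exact_mod_cast hD
  have s1 : ((m : ℝ) + 1) * (6 * k * (C : ℝ) ^ (2 * k)) < ((m : ℝ) + 1) * D := mul_lt_mul_of_pos_left hD' (by positivity)
  have s2 : 2 * k * ((N : ℝ) * D) ≤ 2 * k * (Real.exp 1 * m * (C : ℝ) ^ (2 * k)) := mul_le_mul_of_nonneg_left hND (by positivity)
  have s3 : Real.exp 1 * m * (C : ℝ) ^ (2 * k) ≤ 3 * m * (C : ℝ) ^ (2 * k) :=
    mul_le_mul_of_nonneg_right (mul_le_mul_of_nonneg_right he.le hm0) hCk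
  have s4 : 2 * k * (Real.exp 1 * m * (C : ℝ) ^ (2 * k)) ≤ 2 * k * (3 * m * (C : ℝ) ^ (2 * k)) :=
    mul_le_mul_of_nonneg_left s3 (by positivity)
  have s5 : (0 : ℝ) ≤ k * (C : ℝ) ^ (2 * k) := by positivity
  nlinarith

/-! ### Assembly: `SmallOrbitBlocks` holds -/

/-- A non-lonely coordinate has a class with `≥ 2` elements. -/
theorem two_le_card_cls_of_not_lonely (f : (Fin m → Bool) → Bool) {i : Fin m} (h : ¬ Lonely f i) : 2 ≤ (cls f i).card := by
  rw [Lonely] at h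
  simp only [not_forall, not_not, exists_prop] at h
  obtain ⟨j, hj, hs⟩ := h
  have hsub : ({i, j} : Finset (Fin m)) ⊆ cls f i := by
    intro x hx
    rw [mem_insert, mem_singleton] at hx
    rcases hx with rfl | rfl
    · exact self_mem_cls f _
    · exact (mem_cls f _ _).2 hs
  calc 2 = ({i, j} : Finset (Fin m)).card := (card_pair hj.symm).symm
    _ ≤ _ := card_le_card hsub

/-- The BIG anchors: labels of classes with `≥ 2` and `> m / D` elements (these classes get the colours). -/
noncomputable def bigAnch (f : (Fin m → Bool) → Bool) (D : ℕ) : Finset (Fin m) :=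
  univ.filter fun a => lab f a = a ∧ 2 ≤ (cls f a).card ∧ m < D * (cls f a).card

/-- Membership in `bigAnch`. -/
theorem mem_bigAnch (f : (Fin m → Bool) → Bool) (D : ℕ) (a : Fin m) :
    a ∈ bigAnch f D ↔ lab f a = a ∧ 2 ≤ (cls f a).card ∧ m < D * (cls f a).card := by simp [bigAnch]

/-- There are fewer than `D` big classes (they are disjoint and each has more than `m / D` points). -/
theorem card_bigAnch_lt (f : (Fin m → Bool) → Bool) {D : ℕ} (hD : 0 < D) : (bigAnch f D).card < D := by
  have hdisj : ∀ a ∈ bigAnch f D, ∀ a' ∈ bigAnch f D, a ≠ a' → Disjoint (cls f a) (cls f a') := by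
    intro a ha a' ha' hne
    rw [Finset.disjoint_left]
    intro x hx hx'
    rw [mem_cls] at hx hx'
    apply hne
    rw [← ((mem_bigAnch f D a).1 ha).1, ← ((mem_bigAnch f D a').1 ha').1]
    exact lab_eq_of_sw f (sw_trans f hx (sw_symm f hx'))
  have hsum : ∑ a ∈ bigAnch f D, (cls f a).card ≤ m := by
    rw [← card_biUnion hdisj]
    exact le_trans (card_le_univ _) (by rw [Fintype.card_fin])
  have h1 : (bigAnch f D).card * (m + 1) ≤ D * m := by
    calc (bigAnch f D).card * (m + 1) = ∑ a ∈ bigAnch f D, (m + 1) := by rw [sum_const, smul_eq_mul]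
      _ ≤ ∑ a ∈ bigAnch f D, D * (cls f a).card := sum_le_sum (fun a ha => ((mem_bigAnch f D a).1 ha).2.2)
      _ = D * ∑ a ∈ bigAnch f D, (cls f a).card := by rw [mul_sum]
      _ ≤ D * m := Nat.mul_le_mul_left D hsum
  by_contra hge
  rw [not_lt] at hge
  have h2 : D * (m + 1) ≤ D * m := le_trans (Nat.mul_le_mul_right _ hge) h1
  nlinarith

/-- Off the free set, a non-lonely coordinate is labelled by a big anchor. -/
theorem lab_mem_bigAnch (f : (Fin m → Bool) → Bool) (D : ℕ) {i : Fin m} (hi : i ∉ freeSet f D) (hl : ¬ Lonely f i) :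
    lab f i ∈ bigAnch f D := by
  have h2 := two_le_card_cls_of_not_lonely f hl
  rw [mem_freeSet, FreePt, not_and] at hi
  have h3 : m < D * (cls f i).card := lt_of_not_ge (hi h2)
  rw [mem_bigAnch, lab_lab, cls_lab]
  exact ⟨rfl, h2, h3⟩

/-- ★★ `SmallOrbitBlocks` HOLDS (kernel): a cut with `≤ C^{m+1}` coordinate-permutes has, off an exceptional set `E` with
`k·#E ≤ m + K(C,k)`, its non-lonely coordinates in `≤ K(C,k) := 6k·C^{2k} + 1` exchangeability classes.  Proof: `E` := the
classes of size in `[2, m/K]`; the anchors-fixed permutations of their non-anchor points give `(#F)! ≤ (m/K)^{#F}·C^{m+1}`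
(`factorial_le_orbit`), impossible by Stirling once `k·#E > m` (`sob_arith`); the classes of size `> m/K` are fewer than `K`. -/
theorem smallOrbitBlocks_holds : SmallOrbitBlocks := by
  intro C k
  rcases Nat.eq_zero_or_pos k with hk | hk
  · refine ⟨1, fun m f _ => ⟨univ, by simp [hk], fun _ => 0, fun i hi => absurd (mem_univ i) hi⟩⟩
  rcases Nat.eq_zero_or_pos C with hC | hC
  · refine ⟨1, fun m f h => ?_⟩
    exfalso
    have hmem : f ∈ orbitS f := by
      have := permF_mem_orbitS f 1
      have e : permF f 1 = f := by
        funext u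
        simp [permF]
      rwa [e] at this
    rw [hC, zero_pow (Nat.succ_ne_zero m)] at h
    exact absurd (card_pos.2 ⟨f, hmem⟩) (by omega)
  set D := 6 * k * C ^ (2 * k) + 1 with hDdef
  have hDpos : 0 < D := Nat.succ_pos _
  refine ⟨D, fun m f horb => ⟨freeSet f D, ?_, ?_⟩⟩
  · by_contra hlt
    rw [not_le] at hlt
    have h2 : k * (freeSet f D).card ≤ 2 * k * (nonAnch f D).card :=
      calc k * (freeSet f D).card ≤ k * (2 * (nonAnch f D).card) := Nat.mul_le_mul_left k (card_freeSet_le f D)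
        _ = 2 * k * (nonAnch f D).card := by ring
    have hN : m + 1 ≤ 2 * k * (nonAnch f D).card := by omega
    have hineq := factorial_le_orbit f hDpos
    exact sob_arith hk hC (by omega) hN (le_trans hineq (Nat.mul_le_mul_left _ horb))
  · have hcard : (bigAnch f D).card ≤ D := (card_bigAnch_lt f hDpos).le
    refine ⟨fun i => if h : lab f i ∈ bigAnch f D then Fin.castLE hcard ((bigAnch f D).equivFin ⟨lab f i, h⟩)
      else ⟨0, hDpos⟩, ?_⟩
    intro i hi j hj hli hlj hc
    have hbi : lab f i ∈ bigAnch f D := lab_mem_bigAnch f D hi hli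
    have hbj : lab f j ∈ bigAnch f D := lab_mem_bigAnch f D hj hlj
    simp only [dif_pos hbi, dif_pos hbj] at hc
    have h1 := (bigAnch f D).equivFin.injective (Fin.castLE_injective hcard hc)
    exact sw_of_lab_eq f (congrArg Subtype.val h1)

end SOBKernel

/-! ### The carving after §11: Leaf ⟸ EC ∧ FL ∧ X with NO support, and B ⟺ EC ∧ FL ∧ AFT ∧ X modulo the field core -/

section FinalCarving
variable {p : ℕ} [hp : Fact p.Prime]

/-- ★ ORBIT BOUND ⟹ ALMOST-FEW up to the lonely set (kernel, unconditional in the structure): for every `k` some `K(C,k)`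
works for every cut with `≤ C^{m+1}` permutes. -/
theorem almostFewL_of_orbitBound {d C : ℕ} (hO : OrbitBoundAt p d C) (k : ℕ) :
    ∃ K : ℕ, ∀ (m : ℕ) (f : (Fin m → Bool) → Bool), HasDegF p f d → AlmostFewL f k K := by
  obtain ⟨K, hK⟩ := smallOrbitBlocks_holds C k
  exact ⟨K, fun m f hf => hK m f (hO m f hf)⟩

/-- ★★ EC ∧ FewLonely ⟹ ALMOST-FEW-TYPES (kernel; Z-free and support-free). -/
theorem almostFewTypes_of_expCount_lonely (hE : ExpCountTwoOdd) (hL : FewLonelyTwoOdd) : AlmostFewTypesTwoOdd :=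
  almostFewTypes_of_expCount_blocks hE smallOrbitBlocks_holds hL

/-- ★★★ THE CARVING (kernel, no support): Leaf ⟸ EC ∧ FewLonely ∧ ExactFromAlmost. -/
theorem fewTypes_of_pieces'' (hE : ExpCountTwoOdd) (hL : FewLonelyTwoOdd) (hX : ExactFromAlmostTwoOdd) : FewTypesTwoOdd :=
  fewTypes_of_pieces' hE smallOrbitBlocks_holds hL hX

/-- ★★★ … and piece B ⟸ PF ∧ EC ∧ FewLonely ∧ ExactFromAlmost (kernel). -/
theorem structureLaw_of_pieces'' (hPF : FieldCorePerPrime) (hE : ExpCountTwoOdd) (hL : FewLonelyTwoOdd)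
    (hX : ExactFromAlmostTwoOdd) : StructureLawTwoOdd :=
  structureLaw_of_pieces' hPF hE smallOrbitBlocks_holds hL hX

/-- ★★★ EXACTNESS (kernel): modulo the field core PF, B ⟺ EC ∧ FewLonely ∧ AlmostFewTypes ∧ ExactFromAlmost. -/
theorem structureLaw_iff_pieces (hPF : FieldCorePerPrime) :
    StructureLawTwoOdd ↔ (ExpCountTwoOdd ∧ FewLonelyTwoOdd ∧ AlmostFewTypesTwoOdd ∧ ExactFromAlmostTwoOdd) :=
  ⟨pieces_of_structureLaw', fun h => structureLaw_of_pieces'' hPF h.1 h.2.1 h.2.2.2⟩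

end FinalCarving

/-! ### Axiom guards -/

/-- info: 'Summit.QuantumAdvantage.QuantumAdvantage.Theorems.CountDial.sob_arith' depends on axioms: [propext, choice, Quot.sound] -/
#guard_msgs in #print axioms sob_arith

/-- info: 'Summit.QuantumAdvantage.QuantumAdvantage.Theorems.CountDial.card_bigAnch_lt' depends on axioms: [propext,
 choice,
 Quot.sound] -/
#guard_msgs in #print axioms card_bigAnch_lt

/-- info: 'Summit.QuantumAdvantage.QuantumAdvantage.Theorems.CountDial.smallOrbitBlocks_holds' depends on axioms: [propext,
 choice,
 Quot.sound] -/
#guard_msgs in #print axioms smallOrbitBlocks_holds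

/-- info: 'Summit.QuantumAdvantage.QuantumAdvantage.Theorems.CountDial.almostFewL_of_orbitBound' depends on axioms: [propext,
 choice,
 Quot.sound] -/
#guard_msgs in #print axioms almostFewL_of_orbitBound

/-- info: 'Summit.QuantumAdvantage.QuantumAdvantage.Theorems.CountDial.almostFewTypes_of_expCount_lonely' depends on axioms: [propext,
 choice,
 Quot.sound] -/
#guard_msgs in #print axioms almostFewTypes_of_expCount_lonely

/-- info: 'Summit.QuantumAdvantage.QuantumAdvantage.Theorems.CountDial.fewTypes_of_pieces''' depends on axioms: [propext,
 choice,
 Quot.sound] -/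
#guard_msgs in #print axioms fewTypes_of_pieces''

/-- info: 'Summit.QuantumAdvantage.QuantumAdvantage.Theorems.CountDial.structureLaw_of_pieces''' depends on axioms: [propext,
 choice,
 Quot.sound] -/
#guard_msgs in #print axioms structureLaw_of_pieces''

/-- info: 'Summit.QuantumAdvantage.QuantumAdvantage.Theorems.CountDial.structureLaw_iff_pieces' depends on axioms: [propext,
 choice,
 Quot.sound] -/
#guard_msgs in #print axioms structureLaw_iff_pieces

end Summit.QuantumAdvantage.QuantumAdvantage.Theorems.CountDial
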